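import Mathlib
import HarnessLib
import Summits.HubbardSuperconductivity.HubbardSuperconductivity.Theorems.KLProgrammeC4aFoldBoxTwoSidedLaw
import Summits.HubbardSuperconductivity.HubbardSuperconductivity.Theorems.KLProgrammeC4aFoldBoxPartnerBand

/-!
# Route `KLProgramme` — crux C4a, S3 brick (B4) «(U1)-LAWS» part 4: the TWO-SIDED and the LOG-FREE FIRST-ORDER LAWS DISCHARGED FOR THE ACTUAL PARTNER BAND on a
# near-caustic box, on BOTH sides of the Fermi level — the `hFlaw` / `hpost` hypotheses of the (U1) window calls become ONE CALL each from the datum `dist₀`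

Cell `gate-hubbard-kl`, seat hubbard-kl-k3c3-p3 (g31; row «implicit-function / monotonicity route for μ(n)»).  Located brick for the (C)-closer lane / the (M4)
assembly of the umklapp first-order ϑ-layer (stub (C) `stub_twoLeg_curvature` of `KLRegimeEngineV17F2`, stmt-HubbardSuperconductivity-20437), memo
HOME/hubbard-kl-k3c3-p3/U1-CAUSTIC-SUP.md §11.  Parts 1–2 compose the laws for an abstract fold-box family; part 3 shows the partner band
`g e y = e_K(S − Φ(e, y+θ))` of a configuration with pair sum `S` (sheet `m`, base angle `θ`) is such a family on a box `|e| ≤ hi`, `y ∈ [α,β] ∋ x₀` near the caustic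
of the sheet `m`.  This file plugs part 3 into parts 1–2:
* §1 **`partnerBand_foldBox_package`** — all fold-box data at once (fold points at every level `|e| ≤ hi`, floor `c₂ = w·u_min²`, ceiling `L₂ = 2K₂msD₁² + w·u_min²`,
  the level-`0` fold value `= δ₀ := inf_{[α,β]}` of the level-`0` band, drift at rates `[1/2, 3/2]` above and below the Fermi level) from: the window hypothesis
  (p623173's modulus `≤ w·u_min²` on the box, pointwise), the slope budget `K₂msD₁(dist₀ + 2hi/(Dt−2A)) ≤ c₂W_m` and the rate window
  `K₂(dist₀ + 2(hi/(Dt−2A) + msD₁Wφ))/(Dt−2A) ≤ 1/2`, `dist₀ = ‖S − 2πm − 2Φ(0, x₀+θ)‖`.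
* §2 **`intervalIntegral_partnerBand_twoSided_lawShape_le`** / **`…_below_le`** — for levels `e ∈ [lo, hi]` above / `−e`, `e ∈ [lo,hi]` below the Fermi surface
  (`0 < lo`), abstract split kernel `K e` (envelopes at floor `e`), weight `X e` (`C¹`, bounded, vanishing at `α, β`), profile `0 ≤ w ≤ W`, height `|e_K| ≤ K₀`, ceiling
  `Γ ≥ max(K₀, hi/2)`, `δ₀ ≠ 0`:  `∫_{lo..hi} w(e)·|∫_{α..β} X(e,v)·(K e)′(e_K(S − Φ(±e, v+θ))) dv| de ≤ A₁·((1 + log⁺(Γ/|δ₀|))²·(1 + (√|δ₀|)⁻¹))` with the explicit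
  `n`-free `A₁` of part 1 at `λ₁ = 1/2`, `λ₂ = 3/2`, `G = K₀` — LITERALLY the `hFlaw` shape of `…C4aCausticWindowCoverDispatch.intervalIntegral_caustic_nearCaustic_umklapp_le`
  keyed to the same `δ₀` (there `c + (Φ(ρ,ϑ+θ) − Φ(0,φ+θ)) = S − Φ(0,φ+θ)` by `…C4aCausticWindowCoverFree.frameLevel_sheetBase_eq`).
* §3 **`intervalIntegral_partnerBand_post_le`** / **`…_below_le`** — the same two integrals `≤ P·(√|δ₀|)⁻¹` with part 2's explicit `P` (`hpost` with `B = R = 0`).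
What the (M4) assembly still supplies per box: `dist₀` small (from the near-caustic witness and `…C4aCausticWindowCoverLocus`), the kernel's envelopes (k3c3-p1's
(M1) files for the frequency-summed split kernel), `X` from the bubble's first-order numerator × the loop partition of unity, and the (N2) pre-side law (part 5).
Sizes binder shape of `…C4aAbsBubbleFoldSheet` + `GeomConstants`; nothing asserts (C), K3 or superconductivity.
References: Salmhofer 1999 §4.5.3 [cite: Salmhofer1999]; FST II CPAM 51 (1998) §3 [cite: FeldmanSalmhoferTrubowitz1998].
-/

noncomputable section

namespace Summit.HubbardSuperconductivity.HubbardSuperconductivity.Theorems.C4a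

set_option linter.dupNamespace false -- summit = problem name (single-conjunct summit), D-0017

open Real Set MeasureTheory intervalIntegral
open Literature.MathematicalPhysics.QuantumLattice Literature.MathematicalPhysics.QuantumLattice.BandSectorCounting
open Literature.MathematicalPhysics.QuantumLattice.FermiRG
open Summit.HubbardSuperconductivity.HubbardSuperconductivity.Theorems.KLRegimeSplit
open Summit.HubbardSuperconductivity.HubbardSuperconductivity.Theorems.DispersionFlow
open Summit.HubbardSuperconductivity.HubbardSuperconductivity.Theorems.PerturbedFermiCurve

section Sizes

variable {K : TrigPolyC4v} {A : ℝ} (hA : ∀ p : Momentum, ∀ j ≤ 2, ‖iteratedFDeriv ℝ j (frameShift K) p‖ ≤ A) (hA20 : A ≤ 1 / 20)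
  (hd : klCurveD ≤ (bandBounds (show (-4 : ℝ) < -1.1 by norm_num) (show (-1.1 : ℝ) ≤ -0.1 by norm_num)
    (show (-0.1 : ℝ) < 0 by norm_num)).Dtmin - 2 * A)
  {μ r : ℝ} (hr : 0 < r) (hlo : (-1.1 : ℝ) < μ - r - A) (hhi : μ + r + A < -0.1)
  {A₃ A₄ : ℝ} (hA₃ : ∀ p : Momentum, ‖iteratedFDeriv ℝ 3 (frameShift K) p‖ ≤ A₃)
  (hA₄ : ∀ p : Momentum, ‖iteratedFDeriv ℝ 4 (frameShift K) p‖ ≤ A₄)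
  {K₁ K₂ K₃ : ℝ} (hK₁ : ∀ p : Momentum, ‖fderiv ℝ (frameLevel μ K) p‖ ≤ K₁) (hK₂ : ∀ p : Momentum, ‖iteratedFDeriv ℝ 2 (frameLevel μ K) p‖ ≤ K₂)
  (hK₃ : ∀ p : Momentum, ‖iteratedFDeriv ℝ 3 (frameLevel μ K) p‖ ≤ K₃)
include hA hA20 hd hr hlo hhi hA₃ hA₄ hK₁ hK₂ hK₃

/-! ## §1 The fold-box package of the partner band -/

/-- **THE FOLD-BOX PACKAGE OF THE PARTNER BAND** (all of part 3 at once).  `GeomConstants`; pair sum `S`, sheet `m`, base angle `θ`; window `[α,β] ∋ x₀` with margins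
`W_m ≤ x₀ − α, β − x₀` and radius `|y − x₀| ≤ Wφ`; levels `|e| ≤ hi < r`; the window hypothesis (p623173's modulus `≤ w·u_min²`, pointwise on the box), the slope budget
and the rate window.  THEN there are fold points `v*(e) ∈ [α,β]` (`|e| ≤ hi`) with: vanishing slope; floor `w·u_min² ≤ ∂_y²g e` and ceiling `|∂_y²g e| ≤ 2K₂msD₁² + w·u_min²`
on the box; `inf_{[α,β]} g 0 = g 0 (v* 0)`; and the drift `g 0 (v* 0) − (3/2)e ≤ g e (v* e) ≤ g 0 (v* 0) − e/2` (`0 ≤ e ≤ hi`),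
`−g 0 (v* 0) − (3/2)s ≤ −g (−s) (v*(−s)) ≤ −g 0 (v* 0) − s/2` (`0 ≤ s ≤ hi`), where `g e y = e_K(S − Φ(e, y+θ))`. -/
theorem partnerBand_foldBox_package {Kc r₀ g₀ w : ℝ} (hG : GeomConstants (frameLevel μ K) Kc r₀ g₀ w) (S : Momentum) (m : Fin 2 → ℤ) (θ : ℝ)
    {α β x₀ Wm Wφ hi : ℝ} (hx₀ : x₀ ∈ Icc α β) (hWα : Wm ≤ x₀ - α) (hWβ : Wm ≤ β - x₀) (hWφ : ∀ y ∈ Icc α β, |y - x₀| ≤ Wφ)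
    (hhi0 : 0 ≤ hi) (hhir : hi < r)
    (hwin : ∀ e ∈ Icc (-hi) hi, ∀ y ∈ Icc α β,
      K₃ * (‖S - WithLp.toLp 2 (fun i => 2 * π * (m i : ℝ)) - (levelPoint μ K 0 (x₀ + θ) + levelPoint μ K 0 (x₀ + θ))‖ +
              |e| / ((bandBounds (show (-4 : ℝ) < -1.1 by norm_num) (show (-1.1 : ℝ) ≤ -0.1 by norm_num) (show (-0.1 : ℝ) < 0 by norm_num)).Dtmin - 2 * A) +
              msD A₃ A₄ 1 * |y - x₀|) * msD A₃ A₄ 1 ^ 2 +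
          K₂ * (radialRowOneConst A ((bandBounds (show (-4 : ℝ) < -1.1 by norm_num) (show (-1.1 : ℝ) ≤ -0.1 by norm_num) (show (-0.1 : ℝ) < 0 by norm_num)).Dtmin -
                2 * A) * |e| + msD A₃ A₄ 2 * |y - x₀|) * (msD A₃ A₄ 1 + msD A₃ A₄ 1) +
          K₂ * (‖S - WithLp.toLp 2 (fun i => 2 * π * (m i : ℝ)) - (levelPoint μ K 0 (x₀ + θ) + levelPoint μ K 0 (x₀ + θ))‖ +
              |e| / ((bandBounds (show (-4 : ℝ) < -1.1 by norm_num) (show (-1.1 : ℝ) ≤ -0.1 by norm_num) (show (-0.1 : ℝ) < 0 by norm_num)).Dtmin - 2 * A) +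
              msD A₃ A₄ 1 * |y - x₀|) * msD A₃ A₄ 2 +
          K₁ * ((uRowTwoConst A A₃ ((bandBounds (show (-4 : ℝ) < -1.1 by norm_num) (show (-1.1 : ℝ) ≤ -0.1 by norm_num) (show (-0.1 : ℝ) < 0 by norm_num)).Dtmin -
                  2 * A) +
                1 / ((bandBounds (show (-4 : ℝ) < -1.1 by norm_num) (show (-1.1 : ℝ) ≤ -0.1 by norm_num) (show (-0.1 : ℝ) < 0 by norm_num)).Dtmin - 2 * A) +
                2 * (radialRowOneConst A ((bandBounds (show (-4 : ℝ) < -1.1 by norm_num) (show (-1.1 : ℝ) ≤ -0.1 by norm_num)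
                    (show (-0.1 : ℝ) < 0 by norm_num)).Dtmin - 2 * A) -
                  1 / ((bandBounds (show (-4 : ℝ) < -1.1 by norm_num) (show (-1.1 : ℝ) ≤ -0.1 by norm_num) (show (-0.1 : ℝ) < 0 by norm_num)).Dtmin - 2 * A))) *
              |e| + msD A₃ A₄ 3 * |y - x₀|) ≤
        w * (bandBounds (show (-4 : ℝ) < -1.1 by norm_num) (show (-1.1 : ℝ) ≤ -0.1 by norm_num) (show (-0.1 : ℝ) < 0 by norm_num)).umin ^ 2)
    (hslope : K₂ * msD A₃ A₄ 1 * (‖S - WithLp.toLp 2 (fun i => 2 * π * (m i : ℝ)) - (2 : ℝ) • levelPoint μ K 0 (x₀ + θ)‖ +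
        2 * (hi / ((bandBounds (show (-4 : ℝ) < -1.1 by norm_num) (show (-1.1 : ℝ) ≤ -0.1 by norm_num) (show (-0.1 : ℝ) < 0 by norm_num)).Dtmin - 2 * A))) ≤
      w * (bandBounds (show (-4 : ℝ) < -1.1 by norm_num) (show (-1.1 : ℝ) ≤ -0.1 by norm_num) (show (-0.1 : ℝ) < 0 by norm_num)).umin ^ 2 * Wm)
    (hrate : K₂ * (‖S - WithLp.toLp 2 (fun i => 2 * π * (m i : ℝ)) - (2 : ℝ) • levelPoint μ K 0 (x₀ + θ)‖ +
          2 * (hi / ((bandBounds (show (-4 : ℝ) < -1.1 by norm_num) (show (-1.1 : ℝ) ≤ -0.1 by norm_num) (show (-0.1 : ℝ) < 0 by norm_num)).Dtmin - 2 * A) +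
            msD A₃ A₄ 1 * Wφ)) /
        ((bandBounds (show (-4 : ℝ) < -1.1 by norm_num) (show (-1.1 : ℝ) ≤ -0.1 by norm_num) (show (-0.1 : ℝ) < 0 by norm_num)).Dtmin - 2 * A) ≤ 1 / 2) :
    ∃ vs : ℝ → ℝ,
      (∀ e ∈ Icc (-hi) hi, vs e ∈ Icc α β ∧ deriv (fun x : ℝ => frameLevel μ K (S - levelPoint μ K e (x + θ))) (vs e) = 0) ∧
      (∀ e ∈ Icc (-hi) hi, ∀ y ∈ Icc α β,
        w * (bandBounds (show (-4 : ℝ) < -1.1 by norm_num) (show (-1.1 : ℝ) ≤ -0.1 by norm_num) (show (-0.1 : ℝ) < 0 by norm_num)).umin ^ 2 ≤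
            iteratedDeriv 2 (fun x : ℝ => frameLevel μ K (S - levelPoint μ K e (x + θ))) y ∧
          |iteratedDeriv 2 (fun x : ℝ => frameLevel μ K (S - levelPoint μ K e (x + θ))) y| ≤
            2 * (K₂ * msD A₃ A₄ 1 ^ 2) +
              w * (bandBounds (show (-4 : ℝ) < -1.1 by norm_num) (show (-1.1 : ℝ) ≤ -0.1 by norm_num) (show (-0.1 : ℝ) < 0 by norm_num)).umin ^ 2) ∧
      sInf ((fun x : ℝ => frameLevel μ K (S - levelPoint μ K 0 (x + θ))) '' Icc α β) = frameLevel μ K (S - levelPoint μ K 0 (vs 0 + θ)) ∧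
      (∀ e ∈ Icc 0 hi,
        frameLevel μ K (S - levelPoint μ K 0 (vs 0 + θ)) - 3 / 2 * e ≤ frameLevel μ K (S - levelPoint μ K e (vs e + θ)) ∧
          frameLevel μ K (S - levelPoint μ K e (vs e + θ)) ≤ frameLevel μ K (S - levelPoint μ K 0 (vs 0 + θ)) - 1 / 2 * e) ∧
      (∀ s ∈ Icc 0 hi,
        -frameLevel μ K (S - levelPoint μ K 0 (vs 0 + θ)) - 3 / 2 * s ≤ -frameLevel μ K (S - levelPoint μ K (-s) (vs (-s) + θ)) ∧
          -frameLevel μ K (S - levelPoint μ K (-s) (vs (-s) + θ)) ≤ -frameLevel μ K (S - levelPoint μ K 0 (vs 0 + θ)) - 1 / 2 * s) := by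
  have hupos := (bandBounds (show (-4 : ℝ) < -1.1 by norm_num) (show (-1.1 : ℝ) ≤ -0.1 by norm_num) (show (-0.1 : ℝ) < 0 by norm_num)).umin_pos
  have hc₂ : 0 < w * (bandBounds (show (-4 : ℝ) < -1.1 by norm_num) (show (-1.1 : ℝ) ≤ -0.1 by norm_num) (show (-0.1 : ℝ) < 0 by norm_num)).umin ^ 2 := by
    have := hG.wmin_pos; positivity
  have her : ∀ e ∈ Icc (-hi) hi, |e| < r := fun e he => abs_lt.2 ⟨by linarith [he.1], by linarith [he.2]⟩
  have hcurv : ∀ e ∈ Icc (-hi) hi, ∀ y ∈ Icc α β,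
      w * (bandBounds (show (-4 : ℝ) < -1.1 by norm_num) (show (-1.1 : ℝ) ≤ -0.1 by norm_num) (show (-0.1 : ℝ) < 0 by norm_num)).umin ^ 2 ≤
          iteratedDeriv 2 (fun x : ℝ => frameLevel μ K (S - levelPoint μ K e (x + θ))) y ∧
        |iteratedDeriv 2 (fun x : ℝ => frameLevel μ K (S - levelPoint μ K e (x + θ))) y| ≤
          2 * (K₂ * msD A₃ A₄ 1 ^ 2) +
            w * (bandBounds (show (-4 : ℝ) < -1.1 by norm_num) (show (-1.1 : ℝ) ≤ -0.1 by norm_num) (show (-0.1 : ℝ) < 0 by norm_num)).umin ^ 2 :=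
    fun e he y hy => partnerBand_curvature_of_window hA hA20 hd hr hlo hhi hA₃ hA₄ hK₁ hK₂ hK₃ hG S m (her e he) θ x₀ y (hwin e he y hy)
  obtain ⟨vs, hvs⟩ := exists_foldPoints_partnerBand hA hA20 hd hlo hhi hA₃ hA₄ hK₂ S m θ hx₀ hWα hWβ hhir hc₂ (fun e he y hy => (hcurv e he y hy).1) hslope
  have hconv : ∀ e ∈ Icc (-hi) hi, ∀ y ∈ Icc α β, 0 ≤ iteratedDeriv 2 (fun x : ℝ => frameLevel μ K (S - levelPoint μ K e (x + θ))) y :=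
    fun e he y hy => hc₂.le.trans (hcurv e he y hy).1
  have hdrift := partnerBand_foldValue_drift hA hA20 hd hlo hhi hA₃ hA₄ hK₂ S m θ hWφ hhi0 hhir hvs hconv hrate
  have h0I : (0 : ℝ) ∈ Icc (-hi) hi := ⟨by linarith, hhi0⟩
  have h0r : |(0 : ℝ)| < r := her 0 h0I
  have hinf : sInf ((fun x : ℝ => frameLevel μ K (S - levelPoint μ K 0 (x + θ))) '' Icc α β) = frameLevel μ K (S - levelPoint μ K 0 (vs 0 + θ)) :=
    sInf_image_eq_of_fold (contDiff_partnerBand_angle hA hd hlo hhi S h0r θ) (hvs 0 h0I).1 (hvs 0 h0I).2 (hconv 0 h0I)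
  exact ⟨vs, hvs, hcurv, hinf, hdrift.1, hdrift.2⟩

/-! ## §2 The two-sided law for the partner band, above and below the Fermi level -/

/-- **THE TWO-SIDED FIRST-ORDER LAW FOR THE PARTNER BAND, ABOVE THE FERMI LEVEL** (`hFlaw` currency).  Package hypotheses of `partnerBand_foldBox_package`; levels
`0 < lo ≤ hi`; abstract split kernel `K e` (`C¹`, `|K e u| ≤ 1/max(e,|u|)`, `|(K e)′ u| ≤ 1/max(e,|u|)²`), weight `X e` (`C¹`, `|X e| ≤ X₀`, `|(X e)′| ≤ X₁` on the
window, `X e α = X e β = 0`), profile `0 ≤ w ≤ W`, height `|e_K| ≤ K₀` (`K₀ > 0`), ceiling `Γ ≥ K₀`, `Γ ≥ hi/2`, and `δ₀ := inf_{[α,β]}` of the level-`0` band `≠ 0`.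
THEN `∫_{lo..hi} w(e)·|∫_{α..β} X(e,v)·(K e)′(e_K(S − Φ(e, v+θ))) dv| de ≤ A₁·((1 + log⁺(Γ/|δ₀|))²·(1 + (√|δ₀|)⁻¹))`, `A₁` = part 1's coefficient at
`λ₁ = 1/2`, `λ₂ = 3/2`, `c₂ = w·u_min²`, `L₂ = 2K₂msD₁² + w·u_min²`, `G = K₀` — `n`-free, uniform in the box and in the configuration. -/
theorem intervalIntegral_partnerBand_twoSided_lawShape_le {Kc r₀ g₀ w : ℝ} (hG : GeomConstants (frameLevel μ K) Kc r₀ g₀ w) (S : Momentum) (m : Fin 2 → ℤ)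
    (θ : ℝ) {α β x₀ Wm Wφ lo hi K₀ X₀ X₁ W Γ : ℝ} {X Kr : ℝ → ℝ → ℝ} {wt : ℝ → ℝ}
    (hx₀ : x₀ ∈ Icc α β) (hWα : Wm ≤ x₀ - α) (hWβ : Wm ≤ β - x₀) (hWφ : ∀ y ∈ Icc α β, |y - x₀| ≤ Wφ)
    (hlo0 : 0 < lo) (hlohi : lo ≤ hi) (hhir : hi < r) (hK₀ : ∀ p : Momentum, |frameLevel μ K p| ≤ K₀) (hK₀pos : 0 < K₀) (hX₀ : 0 ≤ X₀) (hX₁ : 0 ≤ X₁)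
    (hW : 0 ≤ W) (hΓ₁ : K₀ ≤ Γ) (hΓ₂ : hi / 2 ≤ Γ)
    (hδ₀ : 0 < |sInf ((fun x : ℝ => frameLevel μ K (S - levelPoint μ K 0 (x + θ))) '' Icc α β)|)
    (hwin : ∀ e ∈ Icc (-hi) hi, ∀ y ∈ Icc α β,
      K₃ * (‖S - WithLp.toLp 2 (fun i => 2 * π * (m i : ℝ)) - (levelPoint μ K 0 (x₀ + θ) + levelPoint μ K 0 (x₀ + θ))‖ +
              |e| / ((bandBounds (show (-4 : ℝ) < -1.1 by norm_num) (show (-1.1 : ℝ) ≤ -0.1 by norm_num) (show (-0.1 : ℝ) < 0 by norm_num)).Dtmin - 2 * A) +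
              msD A₃ A₄ 1 * |y - x₀|) * msD A₃ A₄ 1 ^ 2 +
          K₂ * (radialRowOneConst A ((bandBounds (show (-4 : ℝ) < -1.1 by norm_num) (show (-1.1 : ℝ) ≤ -0.1 by norm_num) (show (-0.1 : ℝ) < 0 by norm_num)).Dtmin -
                2 * A) * |e| + msD A₃ A₄ 2 * |y - x₀|) * (msD A₃ A₄ 1 + msD A₃ A₄ 1) +
          K₂ * (‖S - WithLp.toLp 2 (fun i => 2 * π * (m i : ℝ)) - (levelPoint μ K 0 (x₀ + θ) + levelPoint μ K 0 (x₀ + θ))‖ +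
              |e| / ((bandBounds (show (-4 : ℝ) < -1.1 by norm_num) (show (-1.1 : ℝ) ≤ -0.1 by norm_num) (show (-0.1 : ℝ) < 0 by norm_num)).Dtmin - 2 * A) +
              msD A₃ A₄ 1 * |y - x₀|) * msD A₃ A₄ 2 +
          K₁ * ((uRowTwoConst A A₃ ((bandBounds (show (-4 : ℝ) < -1.1 by norm_num) (show (-1.1 : ℝ) ≤ -0.1 by norm_num) (show (-0.1 : ℝ) < 0 by norm_num)).Dtmin -
                  2 * A) +
                1 / ((bandBounds (show (-4 : ℝ) < -1.1 by norm_num) (show (-1.1 : ℝ) ≤ -0.1 by norm_num) (show (-0.1 : ℝ) < 0 by norm_num)).Dtmin - 2 * A) +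
                2 * (radialRowOneConst A ((bandBounds (show (-4 : ℝ) < -1.1 by norm_num) (show (-1.1 : ℝ) ≤ -0.1 by norm_num)
                    (show (-0.1 : ℝ) < 0 by norm_num)).Dtmin - 2 * A) -
                  1 / ((bandBounds (show (-4 : ℝ) < -1.1 by norm_num) (show (-1.1 : ℝ) ≤ -0.1 by norm_num) (show (-0.1 : ℝ) < 0 by norm_num)).Dtmin - 2 * A))) *
              |e| + msD A₃ A₄ 3 * |y - x₀|) ≤
        w * (bandBounds (show (-4 : ℝ) < -1.1 by norm_num) (show (-1.1 : ℝ) ≤ -0.1 by norm_num) (show (-0.1 : ℝ) < 0 by norm_num)).umin ^ 2)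
    (hslope : K₂ * msD A₃ A₄ 1 * (‖S - WithLp.toLp 2 (fun i => 2 * π * (m i : ℝ)) - (2 : ℝ) • levelPoint μ K 0 (x₀ + θ)‖ +
        2 * (hi / ((bandBounds (show (-4 : ℝ) < -1.1 by norm_num) (show (-1.1 : ℝ) ≤ -0.1 by norm_num) (show (-0.1 : ℝ) < 0 by norm_num)).Dtmin - 2 * A))) ≤
      w * (bandBounds (show (-4 : ℝ) < -1.1 by norm_num) (show (-1.1 : ℝ) ≤ -0.1 by norm_num) (show (-0.1 : ℝ) < 0 by norm_num)).umin ^ 2 * Wm)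
    (hrate : K₂ * (‖S - WithLp.toLp 2 (fun i => 2 * π * (m i : ℝ)) - (2 : ℝ) • levelPoint μ K 0 (x₀ + θ)‖ +
          2 * (hi / ((bandBounds (show (-4 : ℝ) < -1.1 by norm_num) (show (-1.1 : ℝ) ≤ -0.1 by norm_num) (show (-0.1 : ℝ) < 0 by norm_num)).Dtmin - 2 * A) +
            msD A₃ A₄ 1 * Wφ)) /
        ((bandBounds (show (-4 : ℝ) < -1.1 by norm_num) (show (-1.1 : ℝ) ≤ -0.1 by norm_num) (show (-0.1 : ℝ) < 0 by norm_num)).Dtmin - 2 * A) ≤ 1 / 2)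
    (hK : ∀ e ∈ Icc lo hi, ContDiff ℝ 1 (Kr e)) (hK0 : ∀ e ∈ Icc lo hi, ∀ u, |Kr e u| ≤ (max e |u|)⁻¹)
    (hK1 : ∀ e ∈ Icc lo hi, ∀ u, |deriv (Kr e) u| ≤ (max e |u|)⁻¹ ^ 2)
    (hX : ∀ e ∈ Icc lo hi, ContDiff ℝ 1 (X e)) (hXb : ∀ e ∈ Icc lo hi, ∀ v ∈ Icc α β, |X e v| ≤ X₀)
    (hX₁b : ∀ e ∈ Icc lo hi, ∀ v ∈ Icc α β, |deriv (X e) v| ≤ X₁) (hXα : ∀ e ∈ Icc lo hi, X e α = 0) (hXβ : ∀ e ∈ Icc lo hi, X e β = 0)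
    (hw0 : ∀ e ∈ Icc lo hi, 0 ≤ wt e) (hw : ∀ e ∈ Icc lo hi, wt e ≤ W) :
    ∫ e in lo..hi, wt e * |∫ v in α..β, X e v * deriv (Kr e) (frameLevel μ K (S - levelPoint μ K e (v + θ)))| ≤
      3 * W * ((4 + 2 * (3 / 2 : ℝ) + 1 / 2) / (1 / 2)) *
          (X₀ * (4 / Real.sqrt (2 * (K₂ * msD A₃ A₄ 1 ^ 2) +
                    w * (bandBounds (show (-4 : ℝ) < -1.1 by norm_num) (show (-1.1 : ℝ) ≤ -0.1 by norm_num) (show (-0.1 : ℝ) < 0 by norm_num)).umin ^ 2) +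
                  16 * Real.sqrt (2 * (K₂ * msD A₃ A₄ 1 ^ 2) +
                        w * (bandBounds (show (-4 : ℝ) < -1.1 by norm_num) (show (-1.1 : ℝ) ≤ -0.1 by norm_num) (show (-0.1 : ℝ) < 0 by norm_num)).umin ^ 2) /
                      (w * (bandBounds (show (-4 : ℝ) < -1.1 by norm_num) (show (-1.1 : ℝ) ≤ -0.1 by norm_num) (show (-0.1 : ℝ) < 0 by norm_num)).umin ^ 2) +
                  64 * (2 * (K₂ * msD A₃ A₄ 1 ^ 2) +
                          w * (bandBounds (show (-4 : ℝ) < -1.1 by norm_num) (show (-1.1 : ℝ) ≤ -0.1 by norm_num) (show (-0.1 : ℝ) < 0 by norm_num)).umin ^ 2) ^ 2 *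
                      Real.sqrt (2 * (K₂ * msD A₃ A₄ 1 ^ 2) +
                          w * (bandBounds (show (-4 : ℝ) < -1.1 by norm_num) (show (-1.1 : ℝ) ≤ -0.1 by norm_num) (show (-0.1 : ℝ) < 0 by norm_num)).umin ^ 2) /
                    (w * (bandBounds (show (-4 : ℝ) < -1.1 by norm_num) (show (-1.1 : ℝ) ≤ -0.1 by norm_num) (show (-0.1 : ℝ) < 0 by norm_num)).umin ^ 2) ^ 3) *
              Real.sqrt (4 + 2 * (3 / 2 : ℝ) + 1 / 2) +
            32 * X₁ * (2 * (K₂ * msD A₃ A₄ 1 ^ 2) +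
                  w * (bandBounds (show (-4 : ℝ) < -1.1 by norm_num) (show (-1.1 : ℝ) ≤ -0.1 by norm_num) (show (-0.1 : ℝ) < 0 by norm_num)).umin ^ 2) /
              (w * (bandBounds (show (-4 : ℝ) < -1.1 by norm_num) (show (-1.1 : ℝ) ≤ -0.1 by norm_num) (show (-0.1 : ℝ) < 0 by norm_num)).umin ^ 2) ^ 2) *
        ((1 + log⁺ (Γ / |sInf ((fun x : ℝ => frameLevel μ K (S - levelPoint μ K 0 (x + θ))) '' Icc α β)|)) ^ 2 *
          (1 + (Real.sqrt |sInf ((fun x : ℝ => frameLevel μ K (S - levelPoint μ K 0 (x + θ))) '' Icc α β)|)⁻¹)) := by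
  have hhi0 : 0 ≤ hi := hlo0.le.trans hlohi
  obtain ⟨vs, hvs, hcurv, hinf, hdr, -⟩ :=
    partnerBand_foldBox_package hA hA20 hd hr hlo hhi hA₃ hA₄ hK₁ hK₂ hK₃ hG S m θ hx₀ hWα hWβ hWφ hhi0 hhir hwin hslope hrate
  have hc₂ : 0 < w * (bandBounds (show (-4 : ℝ) < -1.1 by norm_num) (show (-1.1 : ℝ) ≤ -0.1 by norm_num) (show (-0.1 : ℝ) < 0 by norm_num)).umin ^ 2 := by
    have := hG.wmin_pos
    have := (bandBounds (show (-4 : ℝ) < -1.1 by norm_num) (show (-1.1 : ℝ) ≤ -0.1 by norm_num) (show (-0.1 : ℝ) < 0 by norm_num)).umin_pos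
    positivity
  have hsub : ∀ e ∈ Icc lo hi, e ∈ Icc (-hi) hi := fun e he => ⟨by linarith [he.1, hlo0], he.2⟩
  have hsub0 : ∀ e ∈ Icc lo hi, e ∈ Icc 0 hi := fun e he => ⟨hlo0.le.trans he.1, he.2⟩
  have her : ∀ e ∈ Icc lo hi, |e| < r := fun e he => abs_lt.2 ⟨by linarith [he.1, hlo0], by linarith [he.2]⟩
  rw [hinf] at hδ₀ ⊢
  exact intervalIntegral_foldBox_twoSided_lawShape_le (g := fun e x => frameLevel μ K (S - levelPoint μ K e (x + θ))) (vs := vs) (la₁ := 1 / 2) (la₂ := 3 / 2)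
    hlo0 hlohi hc₂ hK₀pos hX₀ hX₁ hW (by norm_num) (by norm_num) hδ₀ (by linarith) (by linarith)
    (fun e he => contDiff_partnerBand_angle hA hd hlo hhi S (her e he) θ) (fun e he => (hvs e (hsub e he)).1) (fun e he => (hvs e (hsub e he)).2)
    (fun e he v hv => (hcurv e (hsub e he) v hv).1) (fun e he v hv => (hcurv e (hsub e he) v hv).2) (fun e _ v _ => hK₀ _)
    (fun e he => hdr e (hsub0 e he)) hK hK0 hK1 hX hXb hX₁b hXα hXβ hw0 hw

/-- **THE TWO-SIDED FIRST-ORDER LAW FOR THE PARTNER BAND, BELOW THE FERMI LEVEL** (`hFlaw` currency; loop levels `−s`, `s ∈ [lo, hi]`, the kernel / weight /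
profile indexed by the depth `s`, kernel floor `s`).  Package hypotheses of `partnerBand_foldBox_package`; levels
`0 < lo ≤ hi`; abstract split kernel `K e` (`C¹`, `|K e u| ≤ 1/max(e,|u|)`, `|(K e)′ u| ≤ 1/max(e,|u|)²`), weight `X e` (`C¹`, `|X e| ≤ X₀`, `|(X e)′| ≤ X₁` on the
window, `X e α = X e β = 0`), profile `0 ≤ w ≤ W`, height `|e_K| ≤ K₀` (`K₀ > 0`), ceiling `Γ ≥ K₀`, `Γ ≥ hi/2`, and `δ₀ := inf_{[α,β]}` of the level-`0` band `≠ 0`.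
THEN `∫_{lo..hi} w(s)·|∫_{α..β} X(s,v)·(K s)′(e_K(S − Φ(−s, v+θ))) dv| ds ≤ A₁·((1 + log⁺(Γ/|δ₀|))²·(1 + (√|δ₀|)⁻¹))` with the SAME `A₁` as above the Fermi
level (part 1's `|m|`-form with `m s = −(fold value at −s)`, `δ₀ ↦ −δ₀`). -/
theorem intervalIntegral_partnerBand_twoSided_lawShape_below_le {Kc r₀ g₀ w : ℝ} (hG : GeomConstants (frameLevel μ K) Kc r₀ g₀ w) (S : Momentum) (m : Fin 2 → ℤ)
    (θ : ℝ) {α β x₀ Wm Wφ lo hi K₀ X₀ X₁ W Γ : ℝ} {X Kr : ℝ → ℝ → ℝ} {wt : ℝ → ℝ}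
    (hx₀ : x₀ ∈ Icc α β) (hWα : Wm ≤ x₀ - α) (hWβ : Wm ≤ β - x₀) (hWφ : ∀ y ∈ Icc α β, |y - x₀| ≤ Wφ)
    (hlo0 : 0 < lo) (hlohi : lo ≤ hi) (hhir : hi < r) (hK₀ : ∀ p : Momentum, |frameLevel μ K p| ≤ K₀) (hK₀pos : 0 < K₀) (hX₀ : 0 ≤ X₀) (hX₁ : 0 ≤ X₁)
    (hW : 0 ≤ W) (hΓ₁ : K₀ ≤ Γ) (hΓ₂ : hi / 2 ≤ Γ)
    (hδ₀ : 0 < |sInf ((fun x : ℝ => frameLevel μ K (S - levelPoint μ K 0 (x + θ))) '' Icc α β)|)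
    (hwin : ∀ e ∈ Icc (-hi) hi, ∀ y ∈ Icc α β,
      K₃ * (‖S - WithLp.toLp 2 (fun i => 2 * π * (m i : ℝ)) - (levelPoint μ K 0 (x₀ + θ) + levelPoint μ K 0 (x₀ + θ))‖ +
              |e| / ((bandBounds (show (-4 : ℝ) < -1.1 by norm_num) (show (-1.1 : ℝ) ≤ -0.1 by norm_num) (show (-0.1 : ℝ) < 0 by norm_num)).Dtmin - 2 * A) +
              msD A₃ A₄ 1 * |y - x₀|) * msD A₃ A₄ 1 ^ 2 +
          K₂ * (radialRowOneConst A ((bandBounds (show (-4 : ℝ) < -1.1 by norm_num) (show (-1.1 : ℝ) ≤ -0.1 by norm_num) (show (-0.1 : ℝ) < 0 by norm_num)).Dtmin -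
                2 * A) * |e| + msD A₃ A₄ 2 * |y - x₀|) * (msD A₃ A₄ 1 + msD A₃ A₄ 1) +
          K₂ * (‖S - WithLp.toLp 2 (fun i => 2 * π * (m i : ℝ)) - (levelPoint μ K 0 (x₀ + θ) + levelPoint μ K 0 (x₀ + θ))‖ +
              |e| / ((bandBounds (show (-4 : ℝ) < -1.1 by norm_num) (show (-1.1 : ℝ) ≤ -0.1 by norm_num) (show (-0.1 : ℝ) < 0 by norm_num)).Dtmin - 2 * A) +
              msD A₃ A₄ 1 * |y - x₀|) * msD A₃ A₄ 2 +
          K₁ * ((uRowTwoConst A A₃ ((bandBounds (show (-4 : ℝ) < -1.1 by norm_num) (show (-1.1 : ℝ) ≤ -0.1 by norm_num) (show (-0.1 : ℝ) < 0 by norm_num)).Dtmin -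
                  2 * A) +
                1 / ((bandBounds (show (-4 : ℝ) < -1.1 by norm_num) (show (-1.1 : ℝ) ≤ -0.1 by norm_num) (show (-0.1 : ℝ) < 0 by norm_num)).Dtmin - 2 * A) +
                2 * (radialRowOneConst A ((bandBounds (show (-4 : ℝ) < -1.1 by norm_num) (show (-1.1 : ℝ) ≤ -0.1 by norm_num)
                    (show (-0.1 : ℝ) < 0 by norm_num)).Dtmin - 2 * A) -
                  1 / ((bandBounds (show (-4 : ℝ) < -1.1 by norm_num) (show (-1.1 : ℝ) ≤ -0.1 by norm_num) (show (-0.1 : ℝ) < 0 by norm_num)).Dtmin - 2 * A))) *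
              |e| + msD A₃ A₄ 3 * |y - x₀|) ≤
        w * (bandBounds (show (-4 : ℝ) < -1.1 by norm_num) (show (-1.1 : ℝ) ≤ -0.1 by norm_num) (show (-0.1 : ℝ) < 0 by norm_num)).umin ^ 2)
    (hslope : K₂ * msD A₃ A₄ 1 * (‖S - WithLp.toLp 2 (fun i => 2 * π * (m i : ℝ)) - (2 : ℝ) • levelPoint μ K 0 (x₀ + θ)‖ +
        2 * (hi / ((bandBounds (show (-4 : ℝ) < -1.1 by norm_num) (show (-1.1 : ℝ) ≤ -0.1 by norm_num) (show (-0.1 : ℝ) < 0 by norm_num)).Dtmin - 2 * A))) ≤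
      w * (bandBounds (show (-4 : ℝ) < -1.1 by norm_num) (show (-1.1 : ℝ) ≤ -0.1 by norm_num) (show (-0.1 : ℝ) < 0 by norm_num)).umin ^ 2 * Wm)
    (hrate : K₂ * (‖S - WithLp.toLp 2 (fun i => 2 * π * (m i : ℝ)) - (2 : ℝ) • levelPoint μ K 0 (x₀ + θ)‖ +
          2 * (hi / ((bandBounds (show (-4 : ℝ) < -1.1 by norm_num) (show (-1.1 : ℝ) ≤ -0.1 by norm_num) (show (-0.1 : ℝ) < 0 by norm_num)).Dtmin - 2 * A) +
            msD A₃ A₄ 1 * Wφ)) /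
        ((bandBounds (show (-4 : ℝ) < -1.1 by norm_num) (show (-1.1 : ℝ) ≤ -0.1 by norm_num) (show (-0.1 : ℝ) < 0 by norm_num)).Dtmin - 2 * A) ≤ 1 / 2)
    (hK : ∀ e ∈ Icc lo hi, ContDiff ℝ 1 (Kr e)) (hK0 : ∀ e ∈ Icc lo hi, ∀ u, |Kr e u| ≤ (max e |u|)⁻¹)
    (hK1 : ∀ e ∈ Icc lo hi, ∀ u, |deriv (Kr e) u| ≤ (max e |u|)⁻¹ ^ 2)
    (hX : ∀ e ∈ Icc lo hi, ContDiff ℝ 1 (X e)) (hXb : ∀ e ∈ Icc lo hi, ∀ v ∈ Icc α β, |X e v| ≤ X₀)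
    (hX₁b : ∀ e ∈ Icc lo hi, ∀ v ∈ Icc α β, |deriv (X e) v| ≤ X₁) (hXα : ∀ e ∈ Icc lo hi, X e α = 0) (hXβ : ∀ e ∈ Icc lo hi, X e β = 0)
    (hw0 : ∀ e ∈ Icc lo hi, 0 ≤ wt e) (hw : ∀ e ∈ Icc lo hi, wt e ≤ W) :
    ∫ e in lo..hi, wt e * |∫ v in α..β, X e v * deriv (Kr e) (frameLevel μ K (S - levelPoint μ K (-e) (v + θ)))| ≤
      3 * W * ((4 + 2 * (3 / 2 : ℝ) + 1 / 2) / (1 / 2)) *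
          (X₀ * (4 / Real.sqrt (2 * (K₂ * msD A₃ A₄ 1 ^ 2) +
                    w * (bandBounds (show (-4 : ℝ) < -1.1 by norm_num) (show (-1.1 : ℝ) ≤ -0.1 by norm_num) (show (-0.1 : ℝ) < 0 by norm_num)).umin ^ 2) +
                  16 * Real.sqrt (2 * (K₂ * msD A₃ A₄ 1 ^ 2) +
                        w * (bandBounds (show (-4 : ℝ) < -1.1 by norm_num) (show (-1.1 : ℝ) ≤ -0.1 by norm_num) (show (-0.1 : ℝ) < 0 by norm_num)).umin ^ 2) /
                      (w * (bandBounds (show (-4 : ℝ) < -1.1 by norm_num) (show (-1.1 : ℝ) ≤ -0.1 by norm_num) (show (-0.1 : ℝ) < 0 by norm_num)).umin ^ 2) +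
                  64 * (2 * (K₂ * msD A₃ A₄ 1 ^ 2) +
                          w * (bandBounds (show (-4 : ℝ) < -1.1 by norm_num) (show (-1.1 : ℝ) ≤ -0.1 by norm_num) (show (-0.1 : ℝ) < 0 by norm_num)).umin ^ 2) ^ 2 *
                      Real.sqrt (2 * (K₂ * msD A₃ A₄ 1 ^ 2) +
                          w * (bandBounds (show (-4 : ℝ) < -1.1 by norm_num) (show (-1.1 : ℝ) ≤ -0.1 by norm_num) (show (-0.1 : ℝ) < 0 by norm_num)).umin ^ 2) /
                    (w * (bandBounds (show (-4 : ℝ) < -1.1 by norm_num) (show (-1.1 : ℝ) ≤ -0.1 by norm_num) (show (-0.1 : ℝ) < 0 by norm_num)).umin ^ 2) ^ 3) *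
              Real.sqrt (4 + 2 * (3 / 2 : ℝ) + 1 / 2) +
            32 * X₁ * (2 * (K₂ * msD A₃ A₄ 1 ^ 2) +
                  w * (bandBounds (show (-4 : ℝ) < -1.1 by norm_num) (show (-1.1 : ℝ) ≤ -0.1 by norm_num) (show (-0.1 : ℝ) < 0 by norm_num)).umin ^ 2) /
              (w * (bandBounds (show (-4 : ℝ) < -1.1 by norm_num) (show (-1.1 : ℝ) ≤ -0.1 by norm_num) (show (-0.1 : ℝ) < 0 by norm_num)).umin ^ 2) ^ 2) *
        ((1 + log⁺ (Γ / |sInf ((fun x : ℝ => frameLevel μ K (S - levelPoint μ K 0 (x + θ))) '' Icc α β)|)) ^ 2 *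
          (1 + (Real.sqrt |sInf ((fun x : ℝ => frameLevel μ K (S - levelPoint μ K 0 (x + θ))) '' Icc α β)|)⁻¹)) := by
  have hhi0 : 0 ≤ hi := hlo0.le.trans hlohi
  obtain ⟨vs, hvs, hcurv, hinf, -, hdr⟩ :=
    partnerBand_foldBox_package hA hA20 hd hr hlo hhi hA₃ hA₄ hK₁ hK₂ hK₃ hG S m θ hx₀ hWα hWβ hWφ hhi0 hhir hwin hslope hrate
  have hc₂ : 0 < w * (bandBounds (show (-4 : ℝ) < -1.1 by norm_num) (show (-1.1 : ℝ) ≤ -0.1 by norm_num) (show (-0.1 : ℝ) < 0 by norm_num)).umin ^ 2 := by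
    have := hG.wmin_pos
    have := (bandBounds (show (-4 : ℝ) < -1.1 by norm_num) (show (-1.1 : ℝ) ≤ -0.1 by norm_num) (show (-0.1 : ℝ) < 0 by norm_num)).umin_pos
    positivity
  have hsub : ∀ e ∈ Icc lo hi, -e ∈ Icc (-hi) hi := fun e he => ⟨by linarith [he.2], by linarith [he.1, hlo0]⟩
  have hsub0 : ∀ e ∈ Icc lo hi, e ∈ Icc 0 hi := fun e he => ⟨hlo0.le.trans he.1, he.2⟩
  have her : ∀ e ∈ Icc lo hi, |(-e)| < r := fun e he => abs_lt.2 ⟨by linarith [he.2], by linarith [he.1, hlo0]⟩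
  rw [hinf] at hδ₀ ⊢
  have hδ₀' : 0 < |(-frameLevel μ K (S - levelPoint μ K 0 (vs 0 + θ)))| := by rwa [abs_neg]
  -- part 1's composition with the reflected profile `m s = −(fold value at −s)`, `δ₀ ↦ −δ₀` (inlined: e-layer ∘ φ-layer ∘ shape adapter)
  have hL₂pos : 0 < 2 * (K₂ * msD A₃ A₄ 1 ^ 2) +
      w * (bandBounds (show (-4 : ℝ) < -1.1 by norm_num) (show (-1.1 : ℝ) ≤ -0.1 by norm_num) (show (-0.1 : ℝ) < 0 by norm_num)).umin ^ 2 := by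
    have hK₂0 : 0 ≤ K₂ := (norm_nonneg _).trans (hK₂ 0)
    positivity
  have hA' : 0 ≤ X₀ * (4 / Real.sqrt (2 * (K₂ * msD A₃ A₄ 1 ^ 2) +
          w * (bandBounds (show (-4 : ℝ) < -1.1 by norm_num) (show (-1.1 : ℝ) ≤ -0.1 by norm_num) (show (-0.1 : ℝ) < 0 by norm_num)).umin ^ 2) +
        16 * Real.sqrt (2 * (K₂ * msD A₃ A₄ 1 ^ 2) +
              w * (bandBounds (show (-4 : ℝ) < -1.1 by norm_num) (show (-1.1 : ℝ) ≤ -0.1 by norm_num) (show (-0.1 : ℝ) < 0 by norm_num)).umin ^ 2) /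
            (w * (bandBounds (show (-4 : ℝ) < -1.1 by norm_num) (show (-1.1 : ℝ) ≤ -0.1 by norm_num) (show (-0.1 : ℝ) < 0 by norm_num)).umin ^ 2) +
        64 * (2 * (K₂ * msD A₃ A₄ 1 ^ 2) +
                w * (bandBounds (show (-4 : ℝ) < -1.1 by norm_num) (show (-1.1 : ℝ) ≤ -0.1 by norm_num) (show (-0.1 : ℝ) < 0 by norm_num)).umin ^ 2) ^ 2 *
            Real.sqrt (2 * (K₂ * msD A₃ A₄ 1 ^ 2) +
                w * (bandBounds (show (-4 : ℝ) < -1.1 by norm_num) (show (-1.1 : ℝ) ≤ -0.1 by norm_num) (show (-0.1 : ℝ) < 0 by norm_num)).umin ^ 2) /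
          (w * (bandBounds (show (-4 : ℝ) < -1.1 by norm_num) (show (-1.1 : ℝ) ≤ -0.1 by norm_num) (show (-0.1 : ℝ) < 0 by norm_num)).umin ^ 2) ^ 3) := by
    positivity
  have hB' : 0 ≤ 32 * X₁ * (2 * (K₂ * msD A₃ A₄ 1 ^ 2) +
        w * (bandBounds (show (-4 : ℝ) < -1.1 by norm_num) (show (-1.1 : ℝ) ≤ -0.1 by norm_num) (show (-0.1 : ℝ) < 0 by norm_num)).umin ^ 2) /
      (w * (bandBounds (show (-4 : ℝ) < -1.1 by norm_num) (show (-1.1 : ℝ) ≤ -0.1 by norm_num) (show (-0.1 : ℝ) < 0 by norm_num)).umin ^ 2) ^ 2 := by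
    positivity
  have key : ∫ e in lo..hi, wt e * |∫ v in α..β, X e v * deriv (Kr e) (frameLevel μ K (S - levelPoint μ K (-e) (v + θ)))| ≤ _ :=
    intervalIntegral_fold_first_order_layer_le (I := fun e => |∫ v in α..β, X e v * deriv (Kr e) (frameLevel μ K (S - levelPoint μ K (-e) (v + θ)))|)
      (m := fun e => -frameLevel μ K (S - levelPoint μ K (-e) (vs (-e) + θ))) (la₁ := 1 / 2) (la₂ := 3 / 2)
      hlo0 hlohi hW hA' hB' hK₀pos (by norm_num) (by norm_num) hδ₀' (fun e he => hdr e (hsub0 e he)) hw0 hw (fun e _ => abs_nonneg _)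
      fun e he => by
        have he0 : 0 < e := hlo0.trans_le he.1
        have hφ := abs_intervalIntegral_mul_deriv_comp_le_fold (g := fun x => frameLevel μ K (S - levelPoint μ K (-e) (x + θ)))
          (hvs (-e) (hsub e he)).1 (contDiff_partnerBand_angle hA hd hlo hhi S (her e he) θ) (hvs (-e) (hsub e he)).2 hc₂
          (fun v hv => (hcurv (-e) (hsub e he) v hv).1) (fun v hv => (hcurv (-e) (hsub e he) v hv).2) hK₀pos (fun v _ => hK₀ _)
          (hK e he) he0 (hK0 e he) (hK1 e he) (hX e he) (hXb e he) (hX₁b e he) (hXα e he) (hXβ e he)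
        have hM : 0 < max e |frameLevel μ K (S - levelPoint μ K (-e) (vs (-e) + θ))| := lt_max_of_lt_left he0
        rw [abs_neg]
        exact hφ.trans (fold_law_shape_le hM hc₂ hL₂pos hX₀ hX₁ Real.posLog_nonneg)
  rw [abs_neg] at key
  exact key.trans (twoSided_value_le_lawShape hW hA' hB' hK₀pos.le (hlo0.le.trans hlohi) hδ₀ (by norm_num) (by norm_num) (by linarith) (by linarith))

end Sizes

end Summit.HubbardSuperconductivity.HubbardSuperconductivity.Theorems.C4a

end
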